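import Literature.NumberTheory.Transcendental.KaehlerHodgeSmoothProofs
import Literature.NumberTheory.Transcendental.DolbeaultFunSmulProofs
import Literature.Geometry.Kaehler.KaehlerSymbolIdentityProofs
import Literature.Geometry.Kaehler.KaehlerProofs

/-!
# The Lefschetz operator `L = ω ∧ ·` in the CAR calculus: smoothness, and Leibniz for `∂̄*`

Manifold layer between the pointwise symbol identity (`KaehlerSymbolIdentityProofs.lean`,
`KaehlerSymbolIdentityOpProofs.lean`: Voisin's Lemma 6.6) and the Kähler identity `[∂̄*, L] = i∂`.
On a complex manifold `M` (charts in the complex normed space `E`, holomorphic transition maps) with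
a Riemannian metric on the real tangent bundle:

* **naturality** of `wedgeOne`, `alternatizeUncurryFin` and of the Lefschetz-type operators
  `L_θ η = alternatizeUncurryFin (v ↦ θ v ∧ η)` under pull-back by a continuous linear map
  (`wedgeOne_compContinuousLinearMap`, `alternatizeUncurryFin_compContinuousLinearMap_eq`,
  `lef_compContinuousLinearMap`; Warner (1983), 2.22–2.23);
* the **model Lefschetz operator** of a real bilinear form `B` on `E`: `L_B η = L_{θ_B} η` with
  `θ_B v = ½ B(i v, ·)` — for `B = g_x` a Hermitian metric this is `ω ∧ η` in the alternatization
  convention of Mathlib's `extDeriv` (`ω(u, v) = g(iu, v)` the Kähler form, Voisin (2002), §3.1.1,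
  Lemma 3.3) — written out in model-space types (no new definition): linearity in `η` and in `B`,
  an operator-norm bound and **smoothness in `(B, η)`** (`contDiff_lopE`, a bounded bilinear map);
* the **Lefschetz operator of a metric on forms**, `x ↦ L_{G x} (β x)` for a family
  `G : M → E →L[ℝ] E →L[ℝ] ℝ` of bilinear forms which *is* the metric (`G x v w = ⟪v, w⟫ₓ`), and its
  **smoothness** `isSmoothForm_lform` for smooth `β` and a `C^∞` metric (chart computation: the
  representative of `L β` in the chart at `x₀` is `L_{Ĝ}(β̂)` with `Ĝ` the coordinate expression of
  the metric; Voisin (2002), §3.1.2, "Lemma 3.3 with parameters", exactly as for the Kähler form in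
  `KaehlerProofs.lean`);
* the pointwise value of the `ℂ`-linear Hodge star (`cHodgeStar_apply_pt`), `⋆(ρ β) = ρ ⋆β`, the
  Leibniz rule for `∂` at a point as an identity of forms (`dolbeault_fun_smul_sub`, from
  `dolbeault_fun_smul_apply`) and the **Leibniz rule for `∂̄* = -⋆∂⋆`**:
  `∂̄*(ρ γ) x = ρ x • ∂̄*γ x - ⋆(∂ρ ∧ ⋆γ) x` (`dolbeaultBarAdjoint_fun_smul_apply`): `∂̄*` is a
  first-order operator with symbol `-⋆(ξ^{1,0} ∧ ⋆ ·)` (Voisin (2002), §5.1.2; proof of Lemma 6.6,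
  p. 140).

Conventions. Forms at a point are handled in the model-space types `E [⋀^Fin k]→L[ℝ] ℂ`
(`TangentSpace 𝓘(ℝ, E) x = E`); the Hodge star is the one of the tangent space with its metric.
The wedge with a covector on the tangent space and on the model space agree
(`wedgeOne_tangentSpace`, extensionally; the two differ only by the instance path).

## References

* C. Voisin, *Hodge Theory and Complex Algebraic Geometry I* (2002), §3.1.1–3.1.2, §5.1.2, §6.1.1.
  [Voisin2002]
* F. W. Warner, *Foundations of Differentiable Manifolds and Lie Groups* (1983), 2.22–2.23, 4.10.
  [WarnerGTM94]
-/

noncomputable section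

open scoped Manifold ContDiff Topology RealInnerProductSpace
open Set Finset ContinuousAlternatingMap Function Complex Bundle Module
open Literature.LinearAlgebra.Alternating Literature.Analysis.Complex
open Literature.Geometry.Kaehler

namespace Literature.NumberTheory.Transcendental

set_option quotPrecheck false

/-! ### Naturality of the CAR operations under pull-back -/

section Naturality

variable {V W : Type*} [NormedAddCommGroup V] [NormedSpace ℝ V] [NormedAddCommGroup W]
  [NormedSpace ℝ W] {F : Type*} [NormedAddCommGroup F] [NormedSpace ℝ F]
  {𝕜' : Type*} [NormedField 𝕜'] [NormedAlgebra ℝ 𝕜'] [NormedSpace 𝕜' F] [IsScalarTower ℝ 𝕜' F]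
  {j : ℕ}

/-- **Pull-back of a wedge with a covector**: `T^*(θ ∧ η) = T^*θ ∧ T^*η`
(Warner (1983), 2.22). [cite: WarnerGTM94, 2.22] -/
theorem wedgeOne_compContinuousLinearMap (θ : V →L[ℝ] 𝕜') (η : V [⋀^Fin j]→L[ℝ] F)
    (T : W →L[ℝ] V) :
    (wedgeOne θ η).compContinuousLinearMap T =
      wedgeOne (θ.comp T) (η.compContinuousLinearMap T) := by
  ext v
  simp only [compContinuousLinearMap_apply, wedgeOne_apply, ContinuousLinearMap.comp_apply,
    comp_apply]
  rfl

/-- **Pull-back of an alternatized family**: `T^*(alternatizeUncurryFin Φ) =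
alternatizeUncurryFin (w ↦ T^*(Φ (T w)))` (hypothesis-style: `hΦ' : Φ' w = T^*(Φ (T w))`).
[cite: WarnerGTM94, 2.22–2.23] -/
theorem alternatizeUncurryFin_compContinuousLinearMap_eq (Φ : V →L[ℝ] V [⋀^Fin j]→L[ℝ] F)
    (T : W →L[ℝ] V) (Φ' : W →L[ℝ] W [⋀^Fin j]→L[ℝ] F)
    (hΦ' : ∀ w, Φ' w = (Φ (T w)).compContinuousLinearMap T) :
    (alternatizeUncurryFin Φ).compContinuousLinearMap T = alternatizeUncurryFin Φ' := by
  ext v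
  simp only [compContinuousLinearMap_apply, alternatizeUncurryFin_apply, hΦ', comp_apply]
  rfl

end Naturality

section LefNaturality

variable {V W : Type*} [NormedAddCommGroup V] [NormedSpace ℝ V] [NormedAddCommGroup W]
  [NormedSpace ℝ W] {j : ℕ}

/-- The canonical family `v ↦ θ v ∧ η` on `V` (cf. `KaehlerSymbolIdentityProofs.lean`). -/
local notation "LefFamV[" θ "]" η:max =>
  ContinuousLinearMap.comp (ContinuousAlternatingMap.alternatizeUncurryFinCLM ℝ V ℂ)
    (ContinuousLinearMap.comp (ContinuousLinearMap.flip
      (ContinuousLinearMap.smulRightL ℝ V (V [⋀^Fin _]→L[ℝ] ℂ)) η) θ)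
/-- The canonical family `w ↦ θ' w ∧ η'` on `W`. -/
local notation "LefFamW[" θ "]" η:max =>
  ContinuousLinearMap.comp (ContinuousAlternatingMap.alternatizeUncurryFinCLM ℝ W ℂ)
    (ContinuousLinearMap.comp (ContinuousLinearMap.flip
      (ContinuousLinearMap.smulRightL ℝ W (W [⋀^Fin _]→L[ℝ] ℂ)) η) θ)

/-- The canonical family on `W` evaluates to `θ' w ∧ η'`.  DUPLICATE (dedup-00639): this is
`Literature.Geometry.Kaehler.lefFam_apply` (`KaehlerSymbolIdentityProofs.lean`), which is already
generic in the normed space; kept only as a deprecated alias. [folklore] -/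
@[deprecated (since := "2026-08-15")]
alias lefFamW_apply := lefFam_apply

/-- **Naturality of the Lefschetz-type operators**: if `θ' w u = θ (T w) (T u)` (the pull-back
bilinear form) then `L_{θ'} (T^*η) = T^*(L_θ η)`. [cite: WarnerGTM94, 2.22–2.23] -/
theorem lef_compContinuousLinearMap (θ : V →L[ℝ] V →L[ℝ] ℝ) (η : V [⋀^Fin j]→L[ℝ] ℂ)
    (T : W →L[ℝ] V) (θ' : W →L[ℝ] W →L[ℝ] ℝ) (hθ' : ∀ w u, θ' w u = θ (T w) (T u)) :
    alternatizeUncurryFin (LefFamW[θ'] (η.compContinuousLinearMap T)) =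
      (alternatizeUncurryFin (LefFamV[θ] η)).compContinuousLinearMap T := by
  refine (alternatizeUncurryFin_compContinuousLinearMap_eq _ T _ fun w ↦ ?_).symm
  rw [lefFam_apply, lefFam_apply, wedgeOne_compContinuousLinearMap]
  congr 1
  ext u
  rw [hθ', ContinuousLinearMap.comp_apply]

end LefNaturality

/-! ### The model Lefschetz operator of a bilinear form -/

set_option hygiene false in
/-- The covector family `θ_B v = ½ B(i v, ·)` of a real bilinear form `B` on the complex model
space `E`. -/
local notation "θE[" B "]" => (2⁻¹ : ℝ) • ContinuousLinearMap.comp B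
  ((Complex.I • ContinuousLinearMap.id ℂ E).restrictScalars ℝ)

set_option hygiene false in
/-- The canonical family `v ↦ θ_B v ∧ η` of the model Lefschetz operator. -/
local notation "LfamE[" B "]" η:max =>
  ContinuousLinearMap.comp (ContinuousAlternatingMap.alternatizeUncurryFinCLM ℝ E ℂ)
    (ContinuousLinearMap.comp (ContinuousLinearMap.flip
      (ContinuousLinearMap.smulRightL ℝ E (E [⋀^Fin _]→L[ℝ] ℂ)) η) (θE[B]))

set_option hygiene false in
/-- The model Lefschetz operator `L_B η = alternatizeUncurryFin (v ↦ θ_B v ∧ η)` (raises the degree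
by `2`; for `B` a Hermitian metric `g`, `L_g η = ω ∧ η` with `ω(u, v) = g(iu, v)`). -/
local notation "LopE[" B "]" η:max =>
  ContinuousAlternatingMap.alternatizeUncurryFin (𝕜 := ℝ) (E := E) (F := ℂ) (LfamE[B] η)

section Model

variable {E : Type*} [NormedAddCommGroup E] [NormedSpace ℂ E] {k : ℕ}

/-- The family of the model Lefschetz operator evaluates to `θ_B v ∧ η`. [folklore] -/
theorem lfamE_apply (B : E →L[ℝ] E →L[ℝ] ℝ) (η : E [⋀^Fin k]→L[ℝ] ℂ) (v : E) :
    (LfamE[B] η) v = wedgeOne ((θE[B]) v) η :=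
  lefFam_apply _ η v

/-- `θ_B v u = ½ B(i v, u)`. [folklore] -/
theorem θE_apply (B : E →L[ℝ] E →L[ℝ] ℝ) (v u : E) : (θE[B]) v u = 2⁻¹ * B (I • v) u := rfl

/-- `L_B` is additive. [folklore] -/
theorem lopE_add (B : E →L[ℝ] E →L[ℝ] ℝ) (η η' : E [⋀^Fin k]→L[ℝ] ℂ) :
    LopE[B] (η + η') = LopE[B] η + LopE[B] η' :=
  lef_add _ η η'

/-- `L_B` commutes with complex scalars. [folklore] -/
theorem lopE_smul (B : E →L[ℝ] E →L[ℝ] ℝ) (c : ℂ) (η : E [⋀^Fin k]→L[ℝ] ℂ) :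
    LopE[B] (c • η) = c • LopE[B] η :=
  lef_smul _ c η

/-- `L_B` commutes with real scalars. [folklore] -/
theorem lopE_real_smul (B : E →L[ℝ] E →L[ℝ] ℝ) (r : ℝ) (η : E [⋀^Fin k]→L[ℝ] ℂ) :
    LopE[B] (r • η) = r • LopE[B] η := by
  rw [← Complex.coe_smul r η, lopE_smul, Complex.coe_smul]

/-- `L_B 0 = 0`. [folklore] -/
theorem lopE_zero (B : E →L[ℝ] E →L[ℝ] ℝ) : LopE[B] (0 : E [⋀^Fin k]→L[ℝ] ℂ) = 0 := by
  rw [← zero_smul ℂ (0 : E [⋀^Fin k]→L[ℝ] ℂ), lopE_smul, zero_smul]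

/-- `L_B (-η) = -L_B η`. [folklore] -/
theorem lopE_neg (B : E →L[ℝ] E →L[ℝ] ℝ) (η : E [⋀^Fin k]→L[ℝ] ℂ) : LopE[B] (-η) = -LopE[B] η := by
  rw [← neg_one_smul ℂ η, lopE_smul, neg_one_smul]

/-- `L_B` respects subtraction. [folklore] -/
theorem lopE_sub (B : E →L[ℝ] E →L[ℝ] ℝ) (η η' : E [⋀^Fin k]→L[ℝ] ℂ) :
    LopE[B] (η - η') = LopE[B] η - LopE[B] η' := by
  rw [sub_eq_add_neg, lopE_add, lopE_neg, ← sub_eq_add_neg]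

/-- The covector family is additive in the bilinear form. [folklore] -/
theorem θE_add (B B' : E →L[ℝ] E →L[ℝ] ℝ) : θE[B + B'] = θE[B] + θE[B'] := by
  ext v u
  simp only [FunLike.coe_smul, FunLike.coe_add, Pi.smul_apply, Pi.add_apply,
    ContinuousLinearMap.coe_comp, Function.comp_apply, smul_eq_mul]
  ring

/-- The covector family is homogeneous in the bilinear form. [folklore] -/
theorem θE_smul (c : ℝ) (B : E →L[ℝ] E →L[ℝ] ℝ) : θE[c • B] = c • θE[B] := by
  ext v u
  simp only [FunLike.coe_smul, Pi.smul_apply, ContinuousLinearMap.coe_comp, Function.comp_apply,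
    smul_eq_mul]
  ring

/-- `L_B` is additive in the bilinear form. [folklore] -/
theorem lopE_add_left (B B' : E →L[ℝ] E →L[ℝ] ℝ) (η : E [⋀^Fin k]→L[ℝ] ℂ) :
    LopE[B + B'] η = LopE[B] η + LopE[B'] η := by
  rw [← alternatizeUncurryFin_add]
  congr 1
  ext1 v
  rw [_root_.add_apply, lfamE_apply, lfamE_apply, lfamE_apply, θE_add, _root_.add_apply,
    wedgeOne_add_left]

/-- `L_B` is homogeneous in the bilinear form. [folklore] -/
theorem lopE_smul_left (c : ℝ) (B : E →L[ℝ] E →L[ℝ] ℝ) (η : E [⋀^Fin k]→L[ℝ] ℂ) :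
    LopE[c • B] η = c • LopE[B] η := by
  rw [← alternatizeUncurryFin_smul]
  congr 1
  ext1 v
  rw [_root_.smul_apply, lfamE_apply, lfamE_apply, θE_smul, _root_.smul_apply,
    wedgeOne_smul_left]

/-- Operator-norm bound for the covector family: `‖θ_B‖ ≤ ‖B‖ ‖i‖`. [folklore] -/
theorem norm_θE_le (B : E →L[ℝ] E →L[ℝ] ℝ) :
    ‖θE[B]‖ ≤ ‖B‖ * ‖(Complex.I • ContinuousLinearMap.id ℂ E).restrictScalars ℝ‖ := by
  refine ContinuousLinearMap.opNorm_le_bound _ (by positivity) fun v ↦ ?_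
  have h2 : ‖(2⁻¹ : ℝ)‖ ≤ 1 := by rw [Real.norm_eq_abs, abs_of_pos (by norm_num)]; norm_num
  calc ‖(θE[B]) v‖ = ‖(2⁻¹ : ℝ) • B (((Complex.I • ContinuousLinearMap.id ℂ E).restrictScalars ℝ) v)‖ :=
        rfl
    _ ≤ ‖(2⁻¹ : ℝ)‖ * ‖B (((Complex.I • ContinuousLinearMap.id ℂ E).restrictScalars ℝ) v)‖ :=
        norm_smul_le (2⁻¹ : ℝ) (B (((Complex.I • ContinuousLinearMap.id ℂ E).restrictScalars ℝ) v))
    _ ≤ 1 * (‖B‖ * (‖(Complex.I • ContinuousLinearMap.id ℂ E).restrictScalars ℝ‖ * ‖v‖)) := by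
        gcongr
        exact (B.le_opNorm _).trans (by gcongr; exact ContinuousLinearMap.le_opNorm _ _)
    _ = ‖B‖ * ‖(Complex.I • ContinuousLinearMap.id ℂ E).restrictScalars ℝ‖ * ‖v‖ := by ring

/-- Operator-norm bound for the family: `‖v ↦ θ_B v ∧ η‖ ≤ (k+1) ‖θ_B‖ ‖η‖`. [folklore] -/
theorem norm_lfamE_le (B : E →L[ℝ] E →L[ℝ] ℝ) (η : E [⋀^Fin k]→L[ℝ] ℂ) :
    ‖LfamE[B] η‖ ≤ (k + 1) * ‖θE[B]‖ * ‖η‖ := by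
  refine ContinuousLinearMap.opNorm_le_bound _ (by positivity) fun v ↦ ?_
  rw [lfamE_apply]
  calc ‖wedgeOne ((θE[B]) v) η‖ ≤ (k + 1) * ‖(θE[B]) v‖ * ‖η‖ := norm_wedgeOne_le _ _
    _ ≤ (k + 1) * (‖θE[B]‖ * ‖v‖) * ‖η‖ := by
        gcongr; exact ContinuousLinearMap.le_opNorm _ _
    _ = (k + 1) * ‖θE[B]‖ * ‖η‖ * ‖v‖ := by ring

/-- **Operator-norm bound for the model Lefschetz operator**:
`‖L_B η‖ ≤ (k+2)(k+1)(‖i‖+1) ‖B‖ ‖η‖`. [folklore] -/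
theorem norm_lopE_le (B : E →L[ℝ] E →L[ℝ] ℝ) (η : E [⋀^Fin k]→L[ℝ] ℂ) :
    ‖LopE[B] η‖ ≤ ((k + 1 + 1) * (k + 1) *
      (‖(Complex.I • ContinuousLinearMap.id ℂ E).restrictScalars ℝ‖ + 1)) * ‖B‖ * ‖η‖ := by
  have h1 : ‖LopE[B] η‖ ≤ ((k + 1 : ℕ) + 1) * ‖LfamE[B] η‖ := norm_alternatizeUncurryFin_le _
  have h2 := norm_lfamE_le B η
  have h3 := norm_θE_le B
  have hI := norm_nonneg ((Complex.I • ContinuousLinearMap.id ℂ E).restrictScalars ℝ)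
  push_cast at h1
  calc ‖LopE[B] η‖ ≤ (k + 1 + 1) * ((k + 1) * ‖θE[B]‖ * ‖η‖) := h1.trans (by gcongr)
    _ ≤ (k + 1 + 1) * ((k + 1) *
          (‖B‖ * (‖(Complex.I • ContinuousLinearMap.id ℂ E).restrictScalars ℝ‖ + 1)) * ‖η‖) := by
        gcongr
        exact h3.trans (by nlinarith [norm_nonneg B])
    _ = ((k + 1 + 1) * (k + 1) *
          (‖(Complex.I • ContinuousLinearMap.id ℂ E).restrictScalars ℝ‖ + 1)) * ‖B‖ * ‖η‖ := by
        ring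

/-- **The model Lefschetz operator is a bounded bilinear map** of (bilinear form, form).
[folklore] -/
theorem isBoundedBilinearMap_lopE :
    IsBoundedBilinearMap ℝ fun p : (E →L[ℝ] E →L[ℝ] ℝ) × (E [⋀^Fin k]→L[ℝ] ℂ) ↦ LopE[p.1] p.2 :=
  { add_left := fun B B' η ↦ lopE_add_left B B' η
    smul_left := fun c B η ↦ lopE_smul_left c B η
    add_right := fun B η η' ↦ lopE_add B η η'
    smul_right := fun c B η ↦ lopE_real_smul B c η
    bound := ⟨(k + 1 + 1) * (k + 1) *
        (‖(Complex.I • ContinuousLinearMap.id ℂ E).restrictScalars ℝ‖ + 1), by positivity,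
      fun B η ↦ norm_lopE_le B η⟩ }

/-- **The model Lefschetz operator is smooth** in the pair (bilinear form, form). [folklore] -/
theorem contDiff_lopE :
    ContDiff ℝ ∞ fun p : (E →L[ℝ] E →L[ℝ] ℝ) × (E [⋀^Fin k]→L[ℝ] ℂ) ↦ LopE[p.1] p.2 :=
  isBoundedBilinearMap_lopE.contDiff

end Model

/-! ### The Lefschetz operator of a metric on forms, and its smoothness -/

set_option hygiene false in
/-- The Lefschetz operator of the family of bilinear forms `G` on `k`-forms on `M`:
`(L β) x = L_{G x} (β x)`, a `(k+2)`-form. -/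
local notation "Lform[" G "]" β:max =>
  @id (MForm 𝓘(ℝ, E) M ℂ (_ + 1 + 1)) (fun x ↦ (LopE[G x] (β x) :))

section Manifold

variable {E : Type*} [NormedAddCommGroup E] [NormedSpace ℂ E]
  {M : Type*} [TopologicalSpace M] [ChartedSpace E M] {k : ℕ}

/-- Unfolding: `(L β) x = L_{G x} (β x)`. [folklore] -/
theorem lform_apply (G : M → E →L[ℝ] E →L[ℝ] ℝ) (β : MForm 𝓘(ℝ, E) M ℂ k) (x : M) :
    (Lform[G] β) x = LopE[G x] (β x) :=
  rfl

/-- `L` is additive on forms. [folklore] -/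
theorem lform_add (G : M → E →L[ℝ] E →L[ℝ] ℝ) (β β' : MForm 𝓘(ℝ, E) M ℂ k) :
    Lform[G] (β + β') = Lform[G] β + Lform[G] β' :=
  funext fun x ↦ lopE_add (G x) (β x) (β' x)

/-- `L` commutes with complex scalars on forms. [folklore] -/
theorem lform_smul (G : M → E →L[ℝ] E →L[ℝ] ℝ) (c : ℂ) (β : MForm 𝓘(ℝ, E) M ℂ k) :
    Lform[G] (c • β) = c • Lform[G] β :=
  funext fun x ↦ lopE_smul (G x) c (β x)

/-- `L` commutes with multiplication by real functions: `L (ρ • β) = ρ • L β`. [folklore] -/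
theorem lform_fun_smul (G : M → E →L[ℝ] E →L[ℝ] ℝ) (ρ : M → ℝ) (β : MForm 𝓘(ℝ, E) M ℂ k) :
    Lform[G] (ρ • β) = ρ • Lform[G] β :=
  funext fun x ↦ lopE_real_smul (G x) (ρ x) (β x)

/-- `L 0 = 0`. [folklore] -/
theorem lform_zero (G : M → E →L[ℝ] E →L[ℝ] ℝ) : Lform[G] (0 : MForm 𝓘(ℝ, E) M ℂ k) = 0 :=
  funext fun x ↦ lopE_zero (G x)

/-! Tangent-typed variants of the linearity of `L_B` (the forms typed on `T_x M = E`; same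
proofs, stated so that they rewrite inside expressions built from forms on the manifold). -/

/-- `L_B` is additive (forms on `T_x M`). [folklore] -/
theorem lopT_add (x : M) (B : E →L[ℝ] E →L[ℝ] ℝ)
    (η η' : TangentSpace 𝓘(ℝ, E) x [⋀^Fin k]→L[ℝ] ℂ) :
    LopE[B] (η + η') = LopE[B] η + LopE[B] η' :=
  lopE_add B η η'

/-- `L_B` commutes with complex scalars (forms on `T_x M`). [folklore] -/
theorem lopT_smul (x : M) (B : E →L[ℝ] E →L[ℝ] ℝ) (c : ℂ)
    (η : TangentSpace 𝓘(ℝ, E) x [⋀^Fin k]→L[ℝ] ℂ) : LopE[B] (c • η) = c • LopE[B] η :=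
  lopE_smul B c η

/-- `L_B` commutes with real scalars (forms on `T_x M`). [folklore] -/
theorem lopT_real_smul (x : M) (B : E →L[ℝ] E →L[ℝ] ℝ) (r : ℝ)
    (η : TangentSpace 𝓘(ℝ, E) x [⋀^Fin k]→L[ℝ] ℂ) : LopE[B] (r • η) = r • LopE[B] η :=
  lopE_real_smul B r η

/-- `L_B (-η) = -L_B η` (forms on `T_x M`). [folklore] -/
theorem lopT_neg (x : M) (B : E →L[ℝ] E →L[ℝ] ℝ) (η : TangentSpace 𝓘(ℝ, E) x [⋀^Fin k]→L[ℝ] ℂ) :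
    LopE[B] (-η) = -LopE[B] η :=
  lopE_neg B η

/-- `L_B` respects subtraction (forms on `T_x M`). [folklore] -/
theorem lopT_sub (x : M) (B : E →L[ℝ] E →L[ℝ] ℝ)
    (η η' : TangentSpace 𝓘(ℝ, E) x [⋀^Fin k]→L[ℝ] ℂ) :
    LopE[B] (η - η') = LopE[B] η - LopE[B] η' :=
  lopE_sub B η η'

/-- `L_B 0 = 0` (forms on `T_x M`). [folklore] -/
theorem lopT_zero (x : M) (B : E →L[ℝ] E →L[ℝ] ℝ) :
    LopE[B] (0 : TangentSpace 𝓘(ℝ, E) x [⋀^Fin k]→L[ℝ] ℂ) = 0 :=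
  lopE_zero B

variable [RiemannianBundle (fun x : M ↦ TangentSpace 𝓘(ℝ, E) x)]
  [IsManifold 𝓘(ℝ, E) ∞ M] [IsManifold 𝓘(ℂ, E) ω M]
  [IsContMDiffRiemannianBundle 𝓘(ℝ, E) ∞ E (fun x : M ↦ TangentSpace 𝓘(ℝ, E) x)]

/-- **The Lefschetz operator of a smooth metric preserves smoothness.** Let `G x` be the metric
of `T_x M` written as a bilinear form on the model space (`hG : G x v w = ⟪v, w⟫ₓ`; e.g.
`G = g.inner` for `g : ContMDiffRiemannianMetric`), on a complex manifold `M` with a `C^∞`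
Riemannian metric. For a smooth complex `k`-form `β`, `x ↦ L_{G x} (β x)` is a smooth
`(k+2)`-form. In the chart at `x₀` its representative is `L_{Ĝ(y)} (β̂ y)` with `(B, η) ↦ L_B η`
smooth (`contDiff_lopE`), `Ĝ` the coordinate expression of the metric (smooth:
`IsContMDiffRiemannianBundle`, `contMDiffAt_section`) and `β̂ = β.inChart x₀` (smooth at the chart
point), because the derivative of the inverse chart is the inverse tangent trivialization
(`TangentBundle.symmL_trivializationAt`), which conjugates the metric
(`trivializationAt_bilinForm_apply₂`), commutes with `i` (`symmL_trivializationAt_I_smul`, where the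
holomorphy of the atlas enters) and pulls the CAR operations back naturally
(`lef_compContinuousLinearMap`). Voisin (2002), §3.1.2 ("Lemma 3.3 with parameters");
Warner (1983), 4.10. [cite: Voisin2002, §3.1.2] -/
theorem isSmoothForm_lform (G : M → E →L[ℝ] E →L[ℝ] ℝ)
    (hG : ∀ (x : M) (v w : TangentSpace 𝓘(ℝ, E) x), G x v w = ⟪v, w⟫)
    {β : MForm 𝓘(ℝ, E) M ℂ k} (hβ : IsSmoothForm β) :
    IsSmoothForm (Lform[G] β) := by
  intro x₀
  obtain ⟨gs, hgs, hinner⟩ := IsContMDiffRiemannianBundle.exists_contMDiff (IB := 𝓘(ℝ, E))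
    (n := ∞) (F := E) (E := fun x : M ↦ TangentSpace 𝓘(ℝ, E) x)
  -- the coordinate expression of the metric at `x₀`, smooth at the chart point
  set Ĝ : E → (E →L[ℝ] E →L[ℝ] ℝ) := (fun x ↦ (trivializationAt (E →L[ℝ] E →L[ℝ] ℝ)
    (fun x : M ↦ TangentSpace 𝓘(ℝ, E) x →L[ℝ] TangentSpace 𝓘(ℝ, E) x →L[ℝ] ℝ) x₀ ⟨x, gs x⟩).2) ∘
      (extChartAt 𝓘(ℝ, E) x₀).symm with hĜ
  have h1 : ContDiffWithinAt ℝ ∞ Ĝ (range 𝓘(ℝ, E)) (extChartAt 𝓘(ℝ, E) x₀ x₀) :=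
    contMDiffWithinAt_iff_contDiffWithinAt.1
      (contMDiffAt_iff_source.1 ((contMDiffAt_section x₀).1 (hgs x₀)))
  -- the chart representative of `L β` is `L_{Ĝ y} (β̂ y)` on the chart target
  have hev : ∀ y ∈ (extChartAt 𝓘(ℝ, E) x₀).target,
      MForm.inChart (Lform[G] β) x₀ y = LopE[Ĝ y] (β.inChart x₀ y) := by
    intro y hy
    set y' : M := (extChartAt 𝓘(ℝ, E) x₀).symm y with hy'
    have hx : y' ∈ (chartAt E x₀).source := by
      rw [← extChartAt_source 𝓘(ℝ, E)]
      exact (extChartAt 𝓘(ℝ, E) x₀).map_target hy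
    have hD : mfderivWithin 𝓘(ℝ, E) 𝓘(ℝ, E) (extChartAt 𝓘(ℝ, E) x₀).symm (range 𝓘(ℝ, E)) y =
        (trivializationAt E (TangentSpace 𝓘(ℝ, E)) x₀).symmL ℝ y' := by
      rw [TangentBundle.symmL_trivializationAt hx, hy', (extChartAt 𝓘(ℝ, E) x₀).right_inv hy]
    -- the pulled-back covector family is that of `Ĝ y`
    have hθ : ∀ w u : E, (θE[Ĝ y]) w u =
        (θE[G y']) (mfderivWithin 𝓘(ℝ, E) 𝓘(ℝ, E) (extChartAt 𝓘(ℝ, E) x₀).symm (range 𝓘(ℝ, E)) y w)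
          (mfderivWithin 𝓘(ℝ, E) 𝓘(ℝ, E) (extChartAt 𝓘(ℝ, E) x₀).symm (range 𝓘(ℝ, E)) y u) := by
      intro w u
      rw [θE_apply, θE_apply, hD, hĜ, comp_apply, ← hy', trivializationAt_bilinForm_apply₂,
        ← hinner, symmL_trivializationAt_I_smul hx, hG, tangentJ_apply]
      rfl
    exact (lef_compContinuousLinearMap (V := E) (W := E) (θE[G y']) (β y') _ (θE[Ĝ y]) hθ).symm
  refine (contDiff_lopE.contDiffAt.comp_contDiffWithinAt _ (h1.prodMk (hβ x₀))).congr_of_eventuallyEq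
    ?_ (hev _ (mem_extChartAt_target x₀))
  exact Filter.eventuallyEq_of_mem (extChartAt_target_mem_nhdsWithin x₀) hev

end Manifold

/-! ### The `ℂ`-linear Hodge star pointwise; Leibniz rules for `∂` and `∂̄*` at a point -/

/-- The complexified Hodge star at a point (pointwise value of `MForm.cHodgeStar`). -/
local notation "⋆ℂ[" o ", " h "]" η:max =>
  ContinuousLinearMap.compContinuousAlternatingMap Complex.ofRealCLM
      (hodgeStar o h (ContinuousLinearMap.compContinuousAlternatingMap Complex.reCLM η)) +
    Complex.I • ContinuousLinearMap.compContinuousAlternatingMap Complex.ofRealCLM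
      (hodgeStar o h (ContinuousLinearMap.compContinuousAlternatingMap Complex.imCLM η))

set_option hygiene false in
/-- The `(1,0)`-part `a^{1,0} = ½ (a ⊗ 1 - i (a ∘ i) ⊗ 1)` of a real covector `a` on the model
space. -/
local notation "π₁₀[" a "]" => (2⁻¹ : ℂ) • (ContinuousLinearMap.comp Complex.ofRealCLM a -
  Complex.I • ContinuousLinearMap.comp Complex.ofRealCLM
    (ContinuousLinearMap.comp a ((Complex.I • ContinuousLinearMap.id ℂ E).restrictScalars ℝ)))

set_option hygiene false in
/-- The chart differential `dρₓ = D(ρ ∘ e⁻¹)(e x)` of a real function at `x` (chart `e` at `x`). -/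
local notation "dρ[" ρ ", " x "]" => fderivWithin ℝ (ρ ∘ (extChartAt 𝓘(ℝ, E) x).symm)
  (Set.range 𝓘(ℝ, E)) (extChartAt 𝓘(ℝ, E) x x)

section Star

variable {E : Type*} [NormedAddCommGroup E] [NormedSpace ℂ E]
  {M : Type*} [TopologicalSpace M] [ChartedSpace E M] {k m : ℕ}

/-- **Model and tangent wedge agree.** The wedge with a covector computed on the tangent space
`T_x M` with its metric instances and on the model space `E` coincide (both are the alternating
sum `∑ (-1)^i θ(vᵢ) η(v₀, …, v̂ᵢ, …)`; they differ only in the instance path, the construction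
`alternatizeUncurryFinCLM` being irreducible). [folklore] -/
theorem wedgeOne_tangentSpace [RiemannianBundle (fun x : M ↦ TangentSpace 𝓘(ℝ, E) x)]
    {𝕜' : Type*} [NormedField 𝕜'] [NormedAlgebra ℝ 𝕜'] [NormedSpace 𝕜' ℂ] [IsScalarTower ℝ 𝕜' ℂ]
    (x : M) (ξ : E →L[ℝ] 𝕜') (η : E [⋀^Fin k]→L[ℝ] ℂ) :
    wedgeOne (E := TangentSpace 𝓘(ℝ, E) x) ξ η = wedgeOne (E := E) ξ η :=
  ContinuousAlternatingMap.ext fun v ↦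
    (wedgeOne_apply (E := TangentSpace 𝓘(ℝ, E) x) ξ η v).trans (wedgeOne_apply (E := E) ξ η v).symm

variable [IsManifold 𝓘(ℂ, E) ω M] [IsManifold 𝓘(ℝ, E) ∞ M]

/-- **Leibniz rule for `∂` at a point, as an identity of forms**: for `ρ` differentiable at `x` and a
smooth complex `k`-form `δ`, `∂(ρ • δ) x - ρ x • ∂δ x = (dρₓ)^{1,0} ∧ δ x`
(`dolbeault_fun_smul_apply` read as forms on the model space). [cite: Voisin2002, §2.3.3] -/
theorem dolbeault_fun_smul_sub {ρ : M → ℝ} {δ : MForm 𝓘(ℝ, E) M ℂ k} {x : M}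
    (hρ : MDifferentiableAt 𝓘(ℝ, E) 𝓘(ℝ, ℝ) ρ x) (hδ : IsSmoothForm δ) :
    dolbeault (ρ • δ) x - ρ x • dolbeault δ x = wedgeOne (E := E) (π₁₀[dρ[ρ, x]]) (δ x) := by
  ext v
  rw [ContinuousAlternatingMap.sub_apply, ContinuousAlternatingMap.smul_apply,
    dolbeault_fun_smul_apply hρ hδ v, add_sub_cancel_left]
  rfl

variable [FiniteDimensional ℂ E] {n : ℕ} [Fact (finrank ℝ E = n)]
  [RiemannianBundle (fun x : M ↦ TangentSpace 𝓘(ℝ, E) x)]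
  (o : (x : M) → Orientation ℝ (TangentSpace 𝓘(ℝ, E) x) (Fin n))

omit [IsManifold 𝓘(ℂ, E) ω M] [IsManifold 𝓘(ℝ, E) ∞ M] in
/-- **Pointwise value of the `ℂ`-linear Hodge star**: `(⋆α) x = ⋆(Re αₓ) ⊗ 1 + i (⋆(Im αₓ) ⊗ 1)`
(definitional). [cite: Huybrechts2005, §1.2 p. 33] -/
theorem cHodgeStar_apply_pt (h : k + m = n) (α : MForm 𝓘(ℝ, E) M ℂ k) (x : M) :
    MForm.cHodgeStar o h α x = ⋆ℂ[o x, h] (α x) :=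
  rfl

omit [IsManifold 𝓘(ℂ, E) ω M] [IsManifold 𝓘(ℝ, E) ∞ M] in
/-- The complexified star at a point commutes with real scalars. [folklore] -/
theorem cHodgeStarPt_real_smul (h : k + m = n) (x : M) (r : ℝ)
    (η : TangentSpace 𝓘(ℝ, E) x [⋀^Fin k]→L[ℝ] ℂ) :
    ⋆ℂ[o x, h] (r • η) = r • ⋆ℂ[o x, h] η := by
  have hre : ContinuousLinearMap.compContinuousAlternatingMap Complex.reCLM (r • η) =
      r • ContinuousLinearMap.compContinuousAlternatingMap Complex.reCLM η := by
    ext v; simp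
  have him : ContinuousLinearMap.compContinuousAlternatingMap Complex.imCLM (r • η) =
      r • ContinuousLinearMap.compContinuousAlternatingMap Complex.imCLM η := by
    ext v; simp
  rw [hre, him, map_smul, map_smul]
  ext v
  simp only [ContinuousAlternatingMap.add_apply, ContinuousAlternatingMap.smul_apply,
    ContinuousLinearMap.compContinuousAlternatingMap_coe, comp_apply, ofRealCLM_apply, smul_eq_mul,
    Complex.real_smul, Complex.ofReal_mul]
  ring

omit [IsManifold 𝓘(ℂ, E) ω M] [IsManifold 𝓘(ℝ, E) ∞ M] in
/-- **`⋆(ρ α) = ρ ⋆α`** for a real function `ρ` (the star is fibrewise linear). [folklore] -/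
theorem cHodgeStar_fun_smul (h : k + m = n) (ρ : M → ℝ) (α : MForm 𝓘(ℝ, E) M ℂ k) :
    MForm.cHodgeStar o h (ρ • α) = ρ • MForm.cHodgeStar o h α :=
  funext fun x ↦ cHodgeStarPt_real_smul o h x (ρ x) (α x)

variable [IsContMDiffRiemannianBundle 𝓘(ℝ, E) ∞ E (fun x : M ↦ TangentSpace 𝓘(ℝ, E) x)]

/-- **Leibniz rule for `∂̄* = -⋆∂⋆` and a real function**, at a point: for `ρ` differentiable at
`x`, `γ` a smooth complex `(k+1)`-form and an orientation family with smooth volume form,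
`∂̄*(ρ • γ) x = ρ x • ∂̄*γ x - ⋆((dρₓ)^{1,0} ∧ ⋆γₓ)`, where `(dρₓ)^{1,0} = ½ (dρₓ ⊗ 1 - i (dρₓ ∘ i) ⊗ 1)`
is the `(1,0)`-part of the chart differential `dρₓ` (as in `dolbeault_fun_smul_apply`), `⋆` the
complexified star at `x` and `∧` the wedge on the tangent space. This is the statement that `∂̄*` is a
first-order operator with symbol `η ↦ -⋆(ξ^{1,0} ∧ ⋆η)` (Voisin (2002), §5.1.2; proof of Lemma 6.6,
p. 140). Proof: `⋆(ρ γ) = ρ ⋆γ` (`cHodgeStar_fun_smul`) and the Leibniz rule for `∂`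
(`dolbeault_fun_smul_sub`). [cite: Voisin2002, §5.1.2; §6.1.1 Lemma 6.6] -/
theorem dolbeaultBarAdjoint_fun_smul_apply (ho : IsSmoothForm (riemannianVolumeForm o))
    (h : (k + 1) + m = n) (h' : (m + 1) + k = n) {ρ : M → ℝ} {γ : MForm 𝓘(ℝ, E) M ℂ (k + 1)}
    {x : M} (hρ : MDifferentiableAt 𝓘(ℝ, E) 𝓘(ℝ, ℝ) ρ x) (hγ : IsSmoothForm γ) :
    dolbeaultBarAdjoint o h (ρ • γ) x = ρ x • dolbeaultBarAdjoint o h γ x -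
      ⋆ℂ[o x, h'] (wedgeOne (E := TangentSpace 𝓘(ℝ, E) x) (π₁₀[dρ[ρ, x]]) (⋆ℂ[o x, h] (γ x))) := by
  have hsm : IsSmoothForm (MForm.cHodgeStar o h γ) := IsSmoothForm.cHodgeStar o ho h hγ
  -- `∂(ρ ⋆γ) x = ρ x • ∂(⋆γ) x + (dρₓ)^{1,0} ∧ (⋆γ) x`
  have hd := eq_add_of_sub_eq' (dolbeault_fun_smul_sub (x := x) hρ hsm)
  rw [← wedgeOne_tangentSpace x] at hd
  rw [dolbeaultBarAdjoint, dolbeaultBarAdjoint, cHodgeStar_fun_smul, Pi.neg_apply, Pi.neg_apply,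
    cHodgeStar_apply_pt, cHodgeStar_apply_pt, hd, cHodgeStarPt_add, cHodgeStarPt_real_smul,
    ← cHodgeStar_apply_pt o h γ x, smul_neg, neg_add']

end Star

end Literature.NumberTheory.Transcendental
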